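import Mathlib
import Literature.MathematicalPhysics.QuantumFieldTheory.OSSectorContinuation
import Literature.MathematicalPhysics.QuantumFieldTheory.OSReconstructionNoE1Proofs
import Literature.Probability.Moments.AnalyticCharFunExponentialMoments
import HarnessLib

/-!
# Disc sections with a uniform bound force the planar spectral cone
(stub `stub_cone_of_discSections`, crux `PlanarSpectralCone`)

Line `two-mirror-lightcone-slots` of crux `MirrorModularBoosts.PlanarSpectralCone`
(stmt-QuantumFields-9664), BACK END, the lever "disc ⇒ strip ⇒ cone by positivity".

Informal statement. Let `μ` be a finite positive measure on energy–momentum space `ℝ⁴`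
(coordinate `0` the energy `p₀`, coordinate `1` the momentum `p₁` along the boost direction)
carried by `{p₀ ≥ 0}`, and suppose that for every `t > 0` the Fourier–Laplace section
`b ↦ ∫ e^{−tp₀ + ibp₁} dμ` is, on `(−t, t)`, the restriction of a function `f_t` holomorphic on
the disc `|β| < t` and bounded there by ONE constant `M` (independent of `t`). Then `μ` charges
nothing outside the closed planar cone: `μ{p₀ < |p₁|} = 0`.

Proof.
1. (Lukacs, *Characteristic Functions*, Thm. 7.1.1 — the Literature file
   `Literature/Probability/Moments/AnalyticCharFunExponentialMoments.lean`.) For fixed `t > 0`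
   let `ν_t` be the push-forward under `p ↦ p₁` of the finite measure `e^{−tp₀} μ`; its
   characteristic function is `f_t` on `(−t, t)`, so `ν_t` has exponential moments of all orders
   `|σ| < t`, its two-sided Laplace transform is `f_t` at imaginary points, and
   `∫ e^{−tp₀ + σp₁} dμ = ∫ e^{σx} dν_t ≤ M` for all `|σ| < t`
   (`ConeOfDiscSections.lintegral_exp_ray_le`).
2. (Ray asymptotics.) On `A = {δ < κp₁ − p₀}` (`0 < κ < 1`, `δ > 0`) the choice `σ = κt` gives
   an integrand `e^{t(κp₁ − p₀)} ≥ e^{tδ}`, so `e^{tδ} μ(A) ≤ M` for all `t > 0`, i.e. `μ(A) = 0`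
   (`ConeOfDiscSections.measure_ray_eq_zero`); symmetrically for `−p₁` with `σ = −κt`. Finally
   `{p₀ < |p₁|} ⊆ {p₀ < 0} ∪ ⋃ₙ (A_{1−1/(n+2), 1/(n+2)} ∪ A'_{1−1/(n+2), 1/(n+2)})` is `μ`-null.

References: E. Lukacs, *Characteristic Functions*, 2nd ed. (1970), Thm. 7.1.1; the ray
argument is folklore (support of a measure from the growth of its Laplace transform).
-/

noncomputable section

namespace Summit.QuantumFields.YangMills.Cruxes.PlanarSpectralCone.TwoMirrorLightconeSlots

open MeasureTheory Complex Set Filter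
open scoped InnerProductSpace ComplexConjugate ENNReal Topology
open Literature.MathematicalPhysics.QuantumLattice Literature.MathematicalPhysics.AQFT
  Literature.MathematicalPhysics.QuantumFieldTheory

local notation "E4" => EuclideanSpace ℝ (Fin 4)

/-! ## Helpers

They live in the sub-namespace `ConeOfDiscSections` (no collisions with sibling stub files). -/

namespace ConeOfDiscSections

/-- **Step 1 — the uniform ray bound.** If `μ` is a finite measure on `ℝ⁴` carried by `{p₀ ≥ 0}`
and the section `b ↦ ∫ e^{−tp₀ + ibp₁} dμ` (`t > 0` fixed) is on `(−t, t)` the restriction of a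
function `f` holomorphic on the disc `|z| < t` with `‖f‖ ≤ M` there, then
`∫⁻ e^{−tp₀ + σp₁} dμ ≤ M` for every real `σ` with `|σ| < t`. This is Lukacs' theorem
(`Literature.Probability.Moments.lintegral_exp_mul_le_of_charFun_eq`) applied to the finite
measure `ν = (p ↦ p₁)_* (e^{−tp₀} μ)` on `ℝ`, whose characteristic function is `f` on `(−t, t)`. -/
theorem lintegral_exp_ray_le (μ : Measure E4) [IsFiniteMeasure μ] (hE : μ {p | p 0 < 0} = 0)
    {M t : ℝ} (ht : 0 < t) {f : ℂ → ℂ} (hf : DifferentiableOn ℂ f (Metric.ball 0 t))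
    (hM : ∀ z ∈ Metric.ball (0 : ℂ) t, ‖f z‖ ≤ M)
    (hfb : ∀ b : ℝ, |b| < t →
      f b = ∫ p, Complex.exp ((((-(t * p 0) : ℝ)) : ℂ) + ((b * p 1 : ℝ) : ℂ) * Complex.I) ∂μ)
    {σ : ℝ} (hσ : |σ| < t) :
    ∫⁻ p, ENNReal.ofReal (Real.exp (-(t * p 0) + σ * p 1)) ∂μ ≤ ENNReal.ofReal M := by
  have hae : ∀ᵐ p ∂μ, 0 ≤ p 0 := by
    rw [ae_iff]
    simpa only [not_le] using hE
  -- the weight `e^{-tp₀}` and the push-forward `ν`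
  obtain ⟨d, hd⟩ : ∃ d : E4 → ℝ≥0∞, d = fun p => ENNReal.ofReal (Real.exp (-(t * p 0))) :=
    ⟨_, rfl⟩
  have hd_meas : Measurable d := by
    rw [hd]
    exact ENNReal.measurable_ofReal.comp
      (by fun_prop : Continuous fun p : E4 => Real.exp (-(t * p 0))).measurable
  have hπc : Continuous fun p : E4 => p 1 := by fun_prop
  have hπ : Measurable fun p : E4 => p 1 := hπc.measurable
  haveI hfin : IsFiniteMeasure (μ.withDensity d) := by
    refine isFiniteMeasure_withDensity (ne_of_lt ?_)
    calc ∫⁻ p, d p ∂μ ≤ ∫⁻ _p, 1 ∂μ := by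
          refine lintegral_mono_ae (hae.mono fun p hp => ?_)
          rw [hd]
          exact ENNReal.ofReal_le_one.2 (Real.exp_le_one_iff.2 (by nlinarith))
      _ < ∞ := by simp
  set ν : Measure ℝ := (μ.withDensity d).map fun p : E4 => p 1 with hν
  -- the characteristic function of `ν` on `(-t, t)` is `f`
  have hchar : ∀ b : ℝ, |b| < t → f b = charFun ν b := by
    intro b hb
    rw [hfb b hb, charFun_apply_real, hν,
      integral_map hπ.aemeasurable (Continuous.aestronglyMeasurable (by fun_prop)),
      integral_withDensity_eq_integral_toReal_smul hd_meas
        (ae_of_all _ fun p => by rw [hd]; exact ENNReal.ofReal_lt_top)]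
    refine integral_congr_ae (ae_of_all _ fun p => ?_)
    rw [hd]
    dsimp only
    rw [ENNReal.toReal_ofReal (Real.exp_pos _).le, Complex.real_smul, Complex.ofReal_exp,
      ← Complex.exp_add]
    congr 1
    push_cast
    ring
  -- Lukacs' theorem for `ν`, transported back to `μ`
  have key := Literature.Probability.Moments.lintegral_exp_mul_le_of_charFun_eq ν ht hf hM
    hchar hσ
  calc ∫⁻ p, ENNReal.ofReal (Real.exp (-(t * p 0) + σ * p 1)) ∂μ
      = ∫⁻ p, (d * fun p : E4 => ENNReal.ofReal (Real.exp (σ * p 1))) p ∂μ := by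
        refine lintegral_congr fun p => ?_
        rw [hd, Pi.mul_apply, ← ENNReal.ofReal_mul (Real.exp_pos _).le, ← Real.exp_add]
    _ = ∫⁻ x, ENNReal.ofReal (Real.exp (σ * x)) ∂ν := by
        have hg : Measurable fun x : ℝ => ENNReal.ofReal (Real.exp (σ * x)) :=
          (by fun_prop : Continuous fun x : ℝ => Real.exp (σ * x)).measurable.ennreal_ofReal
        rw [hν, lintegral_map hg hπ, lintegral_withDensity_eq_lintegral_mul _ hd_meas
          (show Measurable (fun p : E4 => ENNReal.ofReal (Real.exp (σ * p 1))) from hg.comp hπ)]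
    _ ≤ ENNReal.ofReal M := key

/-- **Step 2 — ray asymptotics kill the sets `{δ < εκp₁ − p₀}`.** If
`∫⁻ e^{−tp₀ + σp₁} dμ ≤ M` for all `t > 0` and `|σ| < t`, then for `0 < κ < 1`, `δ > 0` and a
sign `ε = ±1` the set `A = {δ < εκ p₁ − p₀}` is `μ`-null: with `σ = εκt`,
`e^{tδ} μ(A) ≤ ∫_A e^{t(εκp₁ − p₀)} dμ ≤ M` for every `t > 0`, and `M e^{−tδ} → 0`. -/
theorem measure_ray_eq_zero (μ : Measure E4) {M : ℝ}
    (hray : ∀ t : ℝ, 0 < t → ∀ σ : ℝ, |σ| < t →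
      ∫⁻ p, ENNReal.ofReal (Real.exp (-(t * p 0) + σ * p 1)) ∂μ ≤ ENNReal.ofReal M)
    {κ δ ε : ℝ} (hκ0 : 0 < κ) (hκ1 : κ < 1) (hδ : 0 < δ) (hε : ε = 1 ∨ ε = -1) :
    μ {p : E4 | δ < ε * κ * p 1 - p 0} = 0 := by
  have hε1 : |ε| = 1 := by rcases hε with rfl | rfl <;> simp
  set A := {p : E4 | δ < ε * κ * p 1 - p 0} with hA_def
  -- `e^{tδ} μ(A) ≤ M` for every `t > 0`
  have hA : ∀ t : ℝ, 0 < t → ENNReal.ofReal (Real.exp (t * δ)) * μ A ≤ ENNReal.ofReal M := by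
    intro t ht
    have hσ : |ε * κ * t| < t := by
      rw [abs_mul, abs_mul, hε1, one_mul, abs_of_pos hκ0, abs_of_pos ht]
      nlinarith
    calc ENNReal.ofReal (Real.exp (t * δ)) * μ A
        = ∫⁻ _p in A, ENNReal.ofReal (Real.exp (t * δ)) ∂μ := (setLIntegral_const _ _).symm
      _ ≤ ∫⁻ p in A, ENNReal.ofReal (Real.exp (-(t * p 0) + ε * κ * t * p 1)) ∂μ := by
          refine setLIntegral_mono (ENNReal.measurable_ofReal.comp (Continuous.measurable
            (by fun_prop))) fun p hp => ENNReal.ofReal_le_ofReal (Real.exp_le_exp.2 ?_)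
          have hp' : δ < ε * κ * p 1 - p 0 := hp
          nlinarith
      _ ≤ ∫⁻ p, ENNReal.ofReal (Real.exp (-(t * p 0) + ε * κ * t * p 1)) ∂μ :=
          setLIntegral_le_lintegral _ _
      _ ≤ ENNReal.ofReal M := hray t ht _ hσ
  -- hence `μ(A) ≤ M e^{-tδ} → 0`
  have hA' : ∀ᶠ t : ℝ in atTop, μ A ≤ ENNReal.ofReal (M * Real.exp (-(t * δ))) := by
    filter_upwards [eventually_gt_atTop 0] with t ht
    have hpos : 0 < Real.exp (t * δ) := Real.exp_pos _
    have h1 : μ A ≤ ENNReal.ofReal M / ENNReal.ofReal (Real.exp (t * δ)) := by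
      rw [ENNReal.le_div_iff_mul_le (Or.inl ((ENNReal.ofReal_pos.2 hpos).ne'))
        (Or.inl ENNReal.ofReal_ne_top), mul_comm]
      exact hA t ht
    rwa [← ENNReal.ofReal_div_of_pos hpos, div_eq_mul_inv, ← Real.exp_neg] at h1
  have hlim : Tendsto (fun t : ℝ => ENNReal.ofReal (M * Real.exp (-(t * δ)))) atTop (𝓝 0) := by
    have h1 : Tendsto (fun t : ℝ => Real.exp (-(t * δ))) atTop (𝓝 0) :=
      Real.tendsto_exp_atBot.comp (tendsto_neg_atTop_atBot.comp (tendsto_id.atTop_mul_const hδ))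
    have h2 : Tendsto (fun t : ℝ => ENNReal.ofReal (M * Real.exp (-(t * δ)))) atTop
        (𝓝 (ENNReal.ofReal (M * 0))) :=
      (ENNReal.continuous_ofReal.tendsto _).comp (h1.const_mul M)
    rwa [mul_zero, ENNReal.ofReal_zero] at h2
  exact le_antisymm (ge_of_tendsto hlim hA') bot_le

/-- **Step 3 — the cover.** `{p₀ < |p₁|} ⊆ {p₀ < 0} ∪ ⋃ₙ ({δₙ < κₙp₁ − p₀} ∪ {δₙ < −κₙp₁ − p₀})`
with `κₙ = 1 − 1/(n+2)`, `δₙ = 1/(n+2)`: if `0 ≤ p₀ < |p₁|`, choose `n` with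
`(1 + |p₁|)/(n+2) < |p₁| − p₀`. -/
theorem coneCompl_subset :
    {p : E4 | p 0 < |p 1|} ⊆ {p : E4 | p 0 < 0} ∪
      ⋃ n : ℕ, ({p : E4 | (1 : ℝ) / (n + 2) < 1 * (1 - 1 / (n + 2)) * p 1 - p 0} ∪
        {p : E4 | (1 : ℝ) / (n + 2) < (-1) * (1 - 1 / (n + 2)) * p 1 - p 0}) := by
  intro p hp
  simp only [Set.mem_setOf_eq] at hp
  by_cases h0 : p 0 < 0
  · exact Or.inl h0
  replace h0 : 0 ≤ p 0 := not_lt.1 h0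
  refine Or.inr ?_
  simp only [Set.mem_iUnion, Set.mem_union, Set.mem_setOf_eq]
  have hsub : 0 < |p 1| - p 0 := by linarith
  obtain ⟨n, hn⟩ := exists_nat_gt ((1 + |p 1|) / (|p 1| - p 0))
  refine ⟨n, ?_⟩
  have hn2 : (0 : ℝ) < n + 2 := by positivity
  have key : 1 / ((n : ℝ) + 2) < (1 - 1 / (n + 2)) * |p 1| - p 0 := by
    rw [div_lt_iff₀ hsub] at hn
    rw [div_lt_iff₀ hn2]
    have : ((1 - 1 / ((n : ℝ) + 2)) * |p 1| - p 0) * ((n : ℝ) + 2) =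
        (|p 1| - p 0) * (n + 2) - |p 1| := by
      field_simp
      ring
    rw [this]
    nlinarith
  rcases le_or_gt 0 (p 1) with h1 | h1
  · left
    rw [abs_of_nonneg h1] at key
    linarith
  · right
    rw [abs_of_neg h1] at key
    linarith

end ConeOfDiscSections

/-- **BACK END, the lever — disc sections with a `t`-uniform bound force the cone (pure measure
theory).** A finite positive measure `μ` on energy–momentum space `ℝ⁴` carried by `{p₀ ≥ 0}` whose
Fourier–Laplace sections `b ↦ ∫ e^{−tp₀ + ibp₁} dμ` are, for every `t > 0`, restrictions to
`(−t,t)` of functions holomorphic on the disc `|β| < t` and bounded there by ONE constant `M`,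
charges nothing outside the closed planar cone: `μ{p₀ < |p₁|} = 0`.
Proof: Lukacs' theorem (analytic characteristic function ⇒ exponential moments and
`∫ e^{−tp₀ + σp₁} dμ = f_t(−iσ)`, `|f_t| ≤ M`; `ConeOfDiscSections.lintegral_exp_ray_le`), then
ray asymptotics `e^{tδ} μ{δ < ±κp₁ − p₀} ≤ M` for all `t` (`ConeOfDiscSections.measure_ray_eq_zero`)
and a countable cover of `{p₀ < |p₁|}` (`ConeOfDiscSections.coneCompl_subset`). -/
theorem stub_cone_of_discSections (μ : Measure E4) [IsFiniteMeasure μ]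
    (hE : μ {p | p 0 < 0} = 0) (M : ℝ)
    (hdisc : ∀ t : ℝ, 0 < t → ∃ f : ℂ → ℂ,
      DifferentiableOn ℂ f (Metric.ball 0 t) ∧
        (∀ z ∈ Metric.ball (0 : ℂ) t, ‖f z‖ ≤ M) ∧
          ∀ b : ℝ, |b| < t →
            f b = ∫ p, Complex.exp ((((-(t * p 0) : ℝ)) : ℂ) + ((b * p 1 : ℝ) : ℂ) * Complex.I) ∂μ) :
    μ {p | p 0 < |p 1|} = 0 := by
  -- Step 1: the uniform ray bound `∫⁻ e^{-tp₀ + σp₁} dμ ≤ M`, `|σ| < t`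
  have hray : ∀ t : ℝ, 0 < t → ∀ σ : ℝ, |σ| < t →
      ∫⁻ p, ENNReal.ofReal (Real.exp (-(t * p 0) + σ * p 1)) ∂μ ≤ ENNReal.ofReal M := by
    intro t ht σ hσ
    obtain ⟨f, hf, hM, hfb⟩ := hdisc t ht
    exact ConeOfDiscSections.lintegral_exp_ray_le μ hE ht hf hM hfb hσ
  -- Steps 2 and 3: the sets `{δₙ < ±κₙ p₁ - p₀}` are null and, with `{p₀ < 0}`, cover the goal
  refine measure_mono_null ConeOfDiscSections.coneCompl_subset
    (measure_union_null hE (measure_iUnion_null fun n => measure_union_null ?_ ?_))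
  · have hn2 : (0 : ℝ) < n + 2 := by positivity
    exact ConeOfDiscSections.measure_ray_eq_zero μ hray
      (by rw [sub_pos, div_lt_one hn2]; linarith) (by rw [sub_lt_self_iff]; positivity)
      (by positivity) (Or.inl rfl)
  · have hn2 : (0 : ℝ) < n + 2 := by positivity
    exact ConeOfDiscSections.measure_ray_eq_zero μ hray
      (by rw [sub_pos, div_lt_one hn2]; linarith) (by rw [sub_lt_self_iff]; positivity)
      (by positivity) (Or.inr rfl)

end Summit.QuantumFields.YangMills.Cruxes.PlanarSpectralCone.TwoMirrorLightconeSlots
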